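import Summits.CriticalPhenomena.PercolationContinuityZ3.Theorems.PercNearOneGluingNoHeavyLowerTailThreePointProductFormFibreFlatPreimage
import Summits.CriticalPhenomena.PercolationContinuityZ3.Theorems.PercNearOneGluingNoHeavyLowerTailThreePointProductFormFibreAdjacent
import Summits.CriticalPhenomena.PercolationContinuityZ3.Theorems.PercNearOneGluingNoHeavyLowerTailThreePointProductFormFibreTwoPortLocality
import HarnessLib

/-!
# The forest form of the halving lemma, I: forest configurations, bridges and the unit label
# (Sahi programme, prover prim-sahi-p2 gen 57)

Support file (`--supports stmt-CriticalPhenomena-4575`, helper).  Standard axioms, no sorries, no named facts, no definitions.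
Memo `run/shared/lean/prim/prim-sahi/FROM-prim-sahi-p2-gen57-FOREST-FORM.md` §2 (Theorems A, B) and `…/prim-sahi-p2/gen57/FOR-PROBLEM.md`.

A labelled configuration `z : α → Bool` of the multigraph `(V, α, ends)` is a FOREST when every open label is a bridge of its own endpoints:
`∀ l, z l = true → ∀ x y, ends l = s(x, y) → x ≠ y ∧ ¬ (x ↔ y in z with l closed)` (spelled out inline; no open loops, no two open parallel
copies, no cycles).  This file supplies the groundwork of THEOREM B of the memo (the UNIT IDENTITY `x_{k+1} = Σ_{S0-forests} β`, proved in the companion file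
`…ProductFormFibreForestUnitIdentity`), which turns the forest form (FOR) `#bad forests ≤ #X₁ forests` into the charging form
`#bad forests ≤ Σ_T (e_H(s,K_T) + e_H(c,K_T))`:
* (monotonicity `reachable_of_le` is reused from `…FibreTwoPortLocality`.)
* `reachable_update_true_split` [this work] — opening one label `l = {p, q}`: a connection `x ↔ v` afterwards was there before, or splits as
  `x ↔ p`, `q ↔ v` (or `x ↔ q`, `p ↔ v`) before (closed-set argument, `TransplantRecipes.mem_of_walk`).
* `forest_update_false` [this work] — closing a label of a forest gives a forest.
* **`forest_update_true`** [this work] — opening a label between two SEPARATED vertices of a forest gives a forest.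
* **`exists_unit_label`**, **`unit_label_unique`** [this work] — in a forest in which `a ↔ s`, there is EXACTLY ONE open label joining the vertex `s`
  to the cluster of `a` computed with every label at `s` closed (the first label of the tree path from `s` to `a`).
* `not_reachable_of_unit_closed` [this work] — closing that label separates `a` from `s`.
[folklore] (walks and closed sets); [cite: Gladkov2024, Conjecture 10.1 (p. 18), arXiv:2408.08457] for the conjectures (P)/(v) served.
-/

namespace Summit.CriticalPhenomena.PercolationContinuityZ3.Theorems.ProductFormFibre

open Finset Literature.Probability.Percolation
open Summit.CriticalPhenomena.PercolationContinuityZ3.Theorems (TransplantRecipes.mem_of_walk)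

variable {V α : Type*}

section ForestUnits

variable (ends : α → Sym2 V)

/-- Adjacency in the open graph of a labelled configuration, unfolded. [folklore] -/
theorem adj_labelled_iff (z : α → Bool) (x y : V) :
    (openGraph (labelledOpen ends z)).Adj x y ↔ (∃ b, z b = true ∧ ends b = s(x, y)) ∧ x ≠ y := by
  rw [openGraph_adj]; rfl

/-- Closing a label only removes connections. [folklore] -/
theorem reachable_of_reachable_update_false [DecidableEq α] (z : α → Bool) (l : α) {x y : V}
    (hxy : (openGraph (labelledOpen ends (Function.update z l false))).Reachable x y) :
    (openGraph (labelledOpen ends z)).Reachable x y := by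
  refine reachable_of_le ends (fun b hb => ?_) hxy
  by_cases hbl : b = l
  · subst hbl; simp at hb
  · rwa [Function.update_of_ne hbl] at hb

/-- **Opening one label splits connections through its endpoints.**  If `ends l = s(p, q)` and `x ↔ v` after opening `l`, then, with
`l` closed, either `x ↔ v`, or `x ↔ p` and `q ↔ v`, or `x ↔ q` and `p ↔ v`. [this work] -/
theorem reachable_update_true_split [DecidableEq α] (z : α → Bool) {l : α} {p q : V} (hl : ends l = s(p, q)) {x v : V}
    (hxv : (openGraph (labelledOpen ends (Function.update z l true))).Reachable x v) :
    (openGraph (labelledOpen ends (Function.update z l false))).Reachable x v ∨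
      ((openGraph (labelledOpen ends (Function.update z l false))).Reachable x p ∧
        (openGraph (labelledOpen ends (Function.update z l false))).Reachable q v) ∨
      ((openGraph (labelledOpen ends (Function.update z l false))).Reachable x q ∧
        (openGraph (labelledOpen ends (Function.update z l false))).Reachable p v) := by
  obtain ⟨w⟩ := hxv
  let G0 := openGraph (labelledOpen ends (Function.update z l false))
  refine TransplantRecipes.mem_of_walk (G := openGraph (labelledOpen ends (Function.update z l true)))
    (S := {v | G0.Reachable x v ∨ (G0.Reachable x p ∧ G0.Reachable q v) ∨ (G0.Reachable x q ∧ G0.Reachable p v)})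
    ?_ w (Or.inl (SimpleGraph.Reachable.refl x))
  intro u y hu hadj
  rw [adj_labelled_iff] at hadj
  obtain ⟨⟨b, hb, hbe⟩, huy⟩ := hadj
  by_cases hbl : b = l
  · -- the opened label itself: `{u, y} = {p, q}`
    subst hbl
    rw [hl] at hbe
    rcases Sym2.eq_iff.1 hbe with ⟨rfl, rfl⟩ | ⟨rfl, rfl⟩
    · -- u = p, y = q
      rcases hu with h | ⟨h1, h2⟩ | ⟨h1, h2⟩
      · exact Or.inr (Or.inl ⟨h, SimpleGraph.Reachable.refl _⟩)
      · exact Or.inr (Or.inl ⟨h1, SimpleGraph.Reachable.refl _⟩)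
      · exact Or.inl h1
    · -- u = q, y = p
      rcases hu with h | ⟨h1, h2⟩ | ⟨h1, h2⟩
      · exact Or.inr (Or.inr ⟨h, SimpleGraph.Reachable.refl _⟩)
      · exact Or.inl h1
      · exact Or.inr (Or.inr ⟨h1, SimpleGraph.Reachable.refl _⟩)
  · -- an old label, open in `G0`
    have hadj0 : G0.Adj u y := by
      rw [adj_labelled_iff]
      refine ⟨⟨b, ?_, hbe⟩, huy⟩
      rw [Function.update_of_ne hbl]
      rwa [Function.update_of_ne hbl] at hb
    have huy0 : G0.Reachable u y := hadj0.reachable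
    rcases hu with h | ⟨h1, h2⟩ | ⟨h1, h2⟩
    · exact Or.inl (h.trans huy0)
    · exact Or.inr (Or.inl ⟨h1, h2.trans huy0⟩)
    · exact Or.inr (Or.inr ⟨h1, h2.trans huy0⟩)

/-- **Closing a label of a forest gives a forest.** [this work] -/
theorem forest_update_false [DecidableEq α] (z : α → Bool)
    (hz : ∀ l, z l = true → ∀ x y, ends l = s(x, y) →
      x ≠ y ∧ ¬ (openGraph (labelledOpen ends (Function.update z l false))).Reachable x y)
    (l₀ : α) :
    ∀ l, Function.update z l₀ false l = true → ∀ x y, ends l = s(x, y) →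
      x ≠ y ∧ ¬ (openGraph (labelledOpen ends (Function.update (Function.update z l₀ false) l false))).Reachable x y := by
  intro l hl x y hxy
  have hll : l ≠ l₀ := by rintro rfl; simp at hl
  rw [Function.update_of_ne hll] at hl
  refine ⟨(hz l hl x y hxy).1, fun h => (hz l hl x y hxy).2 ?_⟩
  rw [Function.update_comm (Ne.symm hll)] at h
  exact reachable_of_reachable_update_false ends (Function.update z l false) l₀ h

/-- **Opening a label between two separated vertices of a forest gives a forest.** [this work] -/
theorem forest_update_true [DecidableEq α] (z : α → Bool)
    (hz : ∀ l, z l = true → ∀ x y, ends l = s(x, y) →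
      x ≠ y ∧ ¬ (openGraph (labelledOpen ends (Function.update z l false))).Reachable x y)
    {l₀ : α} {p q : V} (hl₀ : ends l₀ = s(p, q)) (hpq : ¬ (openGraph (labelledOpen ends z)).Reachable p q) :
    ∀ l, Function.update z l₀ true l = true → ∀ x y, ends l = s(x, y) →
      x ≠ y ∧ ¬ (openGraph (labelledOpen ends (Function.update (Function.update z l₀ true) l false))).Reachable x y := by
  have hz0 : z l₀ = false := by
    by_contra hne
    have ht : z l₀ = true := by cases h' : z l₀ <;> simp_all
    have hne' : p ≠ q := fun h => hpq (h ▸ SimpleGraph.Reachable.refl p)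
    exact hpq (SimpleGraph.Adj.reachable ((adj_labelled_iff ends z p q).2 ⟨⟨l₀, ht, hl₀⟩, hne'⟩))
  intro l hl x y hxy
  by_cases hll : l = l₀
  · subst hll
    rw [hl₀] at hxy
    have hupd : Function.update (Function.update z l true) l false = Function.update z l false := by
      funext b; by_cases hb : b = l
      · subst hb; simp
      · simp [Function.update_of_ne hb]
    rw [hupd]
    rcases Sym2.eq_iff.1 hxy with ⟨rfl, rfl⟩ | ⟨rfl, rfl⟩
    · exact ⟨fun h => hpq (h ▸ SimpleGraph.Reachable.refl _),
        fun h => hpq (reachable_of_reachable_update_false ends z l h)⟩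
    · exact ⟨fun h => hpq (h ▸ SimpleGraph.Reachable.refl _),
        fun h => hpq (reachable_of_reachable_update_false ends z l h).symm⟩
  · rw [Function.update_of_ne hll] at hl
    refine ⟨(hz l hl x y hxy).1, fun h => ?_⟩
    -- rewrite the doubly updated configuration as `update (update z l false) l₀ true`
    rw [Function.update_comm (Ne.symm hll)] at h
    have hsplit := reachable_update_true_split ends (Function.update z l false) hl₀ h
    have hback : Function.update (Function.update z l false) l₀ false = Function.update z l false := by
      funext b; by_cases hb : b = l₀
      · subst hb; simp [Function.update_of_ne (Ne.symm hll), hz0]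
      · simp [Function.update_of_ne hb]
    rw [hback] at hsplit
    have hxy' : (openGraph (labelledOpen ends z)).Adj x y :=
      (adj_labelled_iff ends z x y).2 ⟨⟨l, hl, hxy⟩, (hz l hl x y hxy).1⟩
    rcases hsplit with h0 | ⟨h1, h2⟩ | ⟨h1, h2⟩
    · exact (hz l hl x y hxy).2 h0
    · -- p ↔ x – y ↔ q in z
      refine hpq ?_
      have hxp := reachable_of_reachable_update_false ends z l h1
      have hqy := reachable_of_reachable_update_false ends z l h2
      exact (hxp.symm.trans hxy'.reachable).trans hqy.symm
    · refine hpq ?_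
      have hxq := reachable_of_reachable_update_false ends z l h1
      have hpy := reachable_of_reachable_update_false ends z l h2
      exact (hpy.trans hxy'.reachable.symm).trans hxq

/-! ### The unit label: the first label of the tree path from `s` to `a` -/

section Units

variable (a s : V) (zs : (α → Bool) → α → Bool)
  (hzs1 : ∀ z l, s ∈ ends l → zs z l = false) (hzs2 : ∀ z l, s ∉ ends l → zs z l = z l)

include hzs1 in
/-- With every label at `s` closed, nothing reaches `s`. [folklore] -/
theorem not_reachable_zs (has : a ≠ s) (z : α → Bool) : ¬ (openGraph (labelledOpen ends (zs z))).Reachable a s := by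
  intro h
  have key := TransplantRecipes.mem_of_reachable (G := openGraph (labelledOpen ends (zs z))) (S := {v | v ≠ s}) (v := a) has
    (fun u w hu hadj => ?_) h
  · exact key rfl
  · rw [adj_labelled_iff] at hadj
    obtain ⟨⟨b, hb, hbe⟩, _⟩ := hadj
    intro hw
    have : s ∈ ends b := by rw [hbe, hw]; exact Sym2.mem_mk_right _ _
    rw [hzs1 z b this] at hb
    exact Bool.false_ne_true hb

include hzs1 hzs2 in
/-- `zs z` has fewer open labels than `z`. [folklore] -/
theorem reachable_of_reachable_zs (z : α → Bool) {x y : V} (h : (openGraph (labelledOpen ends (zs z))).Reachable x y) :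
    (openGraph (labelledOpen ends z)).Reachable x y := by
  refine reachable_of_le ends (fun b hb => ?_) h
  by_cases hsb : s ∈ ends b
  · rw [hzs1 z b hsb] at hb; exact absurd hb Bool.false_ne_true
  · rwa [hzs2 z b hsb] at hb

include hzs1 hzs2 in
/-- `zs` does not see the labels at `s`: configurations agreeing off the labels at `s` have the same `zs`. [folklore] -/
theorem zs_eq_of_agree {z z' : α → Bool} (h : ∀ l, s ∉ ends l → z l = z' l) : zs z = zs z' := by
  funext l
  by_cases hsl : s ∈ ends l
  · rw [hzs1 z l hsl, hzs1 z' l hsl]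
  · rw [hzs2 z l hsl, hzs2 z' l hsl, h l hsl]

include hzs1 hzs2 in
/-- **If `a ↮ s`, every connection from `a` avoids the labels at `s`.** [this work] -/
theorem reachable_zs_of_not_reachable (has : a ≠ s) (z : α → Bool) (hna : ¬ (openGraph (labelledOpen ends z)).Reachable a s)
    {v : V} (hv : (openGraph (labelledOpen ends z)).Reachable a v) : (openGraph (labelledOpen ends (zs z))).Reachable a v := by
  refine TransplantRecipes.mem_of_reachable (G := openGraph (labelledOpen ends z))
    (S := {v | (openGraph (labelledOpen ends (zs z))).Reachable a v}) (v := a) (SimpleGraph.Reachable.refl a) (fun u w hu hadj => ?_) hv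
  rw [adj_labelled_iff] at hadj
  obtain ⟨⟨b, hb, hbe⟩, huw⟩ := hadj
  by_cases hsb : s ∈ ends b
  · -- a label at `s`: then `u = s` (impossible: `s` is unreachable in `zs z`) or `w = s` (then `a ↔ s` in `z`)
    exfalso
    rw [hbe] at hsb
    rcases Sym2.mem_iff.1 hsb with h | h
    · exact not_reachable_zs ends a s zs hzs1 has z (by rw [h]; exact hu)
    · have hus : (openGraph (labelledOpen ends z)).Reachable u s := by
        rw [h]; exact SimpleGraph.Adj.reachable ((adj_labelled_iff ends z u w).2 ⟨⟨b, hb, hbe⟩, huw⟩)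
      exact hna ((reachable_of_reachable_zs ends s zs hzs1 hzs2 z hu).trans hus)
  · have hadj0 : (openGraph (labelledOpen ends (zs z))).Adj u w :=
      (adj_labelled_iff ends (zs z) u w).2 ⟨⟨b, by rw [hzs2 z b hsb]; exact hb, hbe⟩, huw⟩
    exact SimpleGraph.Reachable.trans hu hadj0.reachable

include hzs1 hzs2 in
/-- **Existence of the unit label.**  If `a ↔ s` (`a ≠ s`) then some OPEN label joins the vertex `s` to the cluster of `a` computed with
every label at `s` closed. [this work] -/
theorem exists_unit_label (has : a ≠ s) (z : α → Bool) (hr : (openGraph (labelledOpen ends z)).Reachable a s) :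
    ∃ l y, z l = true ∧ ends l = s(s, y) ∧ (openGraph (labelledOpen ends (zs z))).Reachable a y := by
  by_contra hno
  have hno' : ∀ b y, z b = true → ends b = s(s, y) → ¬ (openGraph (labelledOpen ends (zs z))).Reachable a y :=
    fun b y hb he hr => hno ⟨b, y, hb, he, hr⟩
  have key := TransplantRecipes.mem_of_reachable (G := openGraph (labelledOpen ends z))
    (S := {v | (openGraph (labelledOpen ends (zs z))).Reachable a v}) (v := a) (SimpleGraph.Reachable.refl a) (fun u w hu hadj => ?_) hr
  · exact not_reachable_zs ends a s zs hzs1 has z key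
  · rw [adj_labelled_iff] at hadj
    obtain ⟨⟨b, hb, hbe⟩, huw⟩ := hadj
    by_cases hsb : s ∈ ends b
    · exfalso
      rw [hbe] at hsb
      rcases Sym2.mem_iff.1 hsb with h | h
      · exact not_reachable_zs ends a s zs hzs1 has z (by rw [h]; exact hu)
      · exact hno' b u hb (by rw [hbe, h, Sym2.eq_swap]) hu
    · have hadj0 : (openGraph (labelledOpen ends (zs z))).Adj u w :=
        (adj_labelled_iff ends (zs z) u w).2 ⟨⟨b, by rw [hzs2 z b hsb]; exact hb, hbe⟩, huw⟩
      exact SimpleGraph.Reachable.trans hu hadj0.reachable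

include hzs1 hzs2 in
/-- **Uniqueness of the unit label in a forest.** [this work] -/
theorem unit_label_unique [DecidableEq α] (z : α → Bool)
    (hz : ∀ l, z l = true → ∀ x y, ends l = s(x, y) →
      x ≠ y ∧ ¬ (openGraph (labelledOpen ends (Function.update z l false))).Reachable x y)
    {l₁ l₂ : α} {y₁ y₂ : V} (h₁ : z l₁ = true) (e₁ : ends l₁ = s(s, y₁)) (r₁ : (openGraph (labelledOpen ends (zs z))).Reachable a y₁)
    (h₂ : z l₂ = true) (e₂ : ends l₂ = s(s, y₂)) (r₂ : (openGraph (labelledOpen ends (zs z))).Reachable a y₂) : l₁ = l₂ := by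
  by_contra hne
  -- `y₁ ↔ y₂` avoiding the labels at `s`, hence in `z` with `l₁` closed; and `s –l₂– y₂` there: so `s ↔ y₁` with `l₁` closed
  have hmono : ∀ b, zs z b = true → Function.update z l₁ false b = true := by
    intro b hb
    by_cases hsb : s ∈ ends b
    · rw [hzs1 z b hsb] at hb; exact absurd hb Bool.false_ne_true
    · have hbl : b ≠ l₁ := by rintro rfl; rw [e₁] at hsb; exact hsb (Sym2.mem_mk_left _ _)
      rw [Function.update_of_ne hbl, ← hzs2 z b hsb]; exact hb
  have hy : (openGraph (labelledOpen ends (Function.update z l₁ false))).Reachable y₁ y₂ :=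
    reachable_of_le ends hmono (r₁.symm.trans r₂)
  have hsy2 : (openGraph (labelledOpen ends (Function.update z l₁ false))).Adj s y₂ :=
    (adj_labelled_iff ends _ s y₂).2 ⟨⟨l₂, by rw [Function.update_of_ne (Ne.symm hne)]; exact h₂, e₂⟩, (hz l₂ h₂ s y₂ e₂).1⟩
  exact (hz l₁ h₁ s y₁ e₁).2 (hsy2.reachable.trans hy.symm)

include hzs1 hzs2 in
/-- **Closing the unit label separates `a` from `s`.** [this work] -/
theorem not_reachable_of_unit_closed [DecidableEq α] (has : a ≠ s) (z : α → Bool)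
    (hz : ∀ l, z l = true → ∀ x y, ends l = s(x, y) →
      x ≠ y ∧ ¬ (openGraph (labelledOpen ends (Function.update z l false))).Reachable x y)
    {l₀ : α} {y₀ : V} (h₀ : z l₀ = true) (e₀ : ends l₀ = s(s, y₀)) (r₀ : (openGraph (labelledOpen ends (zs z))).Reachable a y₀) :
    ¬ (openGraph (labelledOpen ends (Function.update z l₀ false))).Reachable a s := by
  intro h
  obtain ⟨l, y, hl, he, hr⟩ := exists_unit_label ends a s zs hzs1 hzs2 has (Function.update z l₀ false) h
  have hzz : zs (Function.update z l₀ false) = zs z :=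
    zs_eq_of_agree ends s zs hzs1 hzs2 (fun b hb => by
      have : b ≠ l₀ := by rintro rfl; rw [e₀] at hb; exact hb (Sym2.mem_mk_left _ _)
      rw [Function.update_of_ne this])
  rw [hzz] at hr
  have hll : l ≠ l₀ := by rintro rfl; simp at hl
  rw [Function.update_of_ne hll] at hl
  exact hll (unit_label_unique ends a s zs hzs1 hzs2 z hz hl he hr h₀ e₀ r₀)

end Units

end ForestUnits

end Summit.CriticalPhenomena.PercolationContinuityZ3.Theorems.ProductFormFibre
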